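import Summits.FinalStateConjecture.FinalStateConjecture.Theorems.KerrShieldedDataExist.Negative.BentSliceConormal
import HarnessLib

/-!
# `KerrShieldedSettles` — negative-lane lemmas: orientation audit of the Kerr–Schild chart and the
# uniform hole-collar constant (standing disprover, cycle 3)

Support lemmas for crux `stmt-FinalStateConjecture-10054`
(`Summit.FinalStateConjecture.FinalStateConjecture.Theses.SwallowTheDatum.KerrShieldedSettles`, route
SwallowTheDatum), from the standing disprover's work file `Cruxes/KerrShieldedSettles/Disproof.lean` §J
(rev 5), landed so that provers / planners / ideators can import them.  Nothing here asserts a Theses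
decl; no definition is introduced (the sibling lane's `conormalForm` is reused).

**(1) Orientation audit on the tree's own objects.**  The crux's shield puts the compact core INSIDE
`{r < r₁}`, `r₁ < r₊`, with normal `ν` future for `Kerr.timeOrientation = −g♯dt*`.  Exterior ignorance
(the disprover's §C1) needs `{r = r₊}` to be a FUTURE (black-hole) horizon for that orientation; were
the chart the outgoing one, the core would sit in a white hole and `J⁺(core)` would meet the would-be
exterior.  For `a = 0` the tree's `Kerr.bilin M 0 x` is LITERALLY the ingoing Eddington–Finkelstein form
`−(w⁰)² + |w⃗|² + (2M/r)(w⁰ + x⃗·w⃗/r)²` (`bilin_zero_spin_self`); `g(Kerr.timeVector, w) = −w⁰`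
(tree), so a causal `w` is future iff `w⁰ > 0`; inside `r < 2M` every future causal `w` has `x⃗·w⃗ < 0`
(`infall_of_causal_inside`) and on `r = 2M` `x⃗·w⃗ ≤ 0` (`not_outward_of_causal_horizon`).  These are
also the covector facts by which `r₁ < r₊` is consumed ("past-directed causal curves from the exterior
never reach `{r ≤ r₁}`"), and `minkowski_le_bilin` / `spatial_sq_le_of_causal` are the cone comparison
`J⁺_g ⊆ J⁺_η` for every spin.

**(2) The hole-collar constant, uniformly** (crux triage TRIAGE-r2-3, sharpening S1, for the cards
`tapered-temporal-collar`, `three-clocks-pinched-development`, `pinched-sandwich-cauchy`): for EVERY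
slope `κ ∈ [0, ½]`, every `|a| < M`, every `r₋ < r < r₊` and every latitude `c`,
`Σ·g⁻¹(dt* + κ dr, dt* + κ dr) = conormalForm M a r c (−κ) < −Σ` (`conormalForm_hole_collar_lt`):
the conormal of a graph `t* = const − κ r` is timelike with room in the whole hole, from
`Δ = (r − r₊)(r − r₋) < 0` alone — no numerics, no compactness.

**(3) A correction to the disprover's own §H1 (parenthetical).**  `v = t* + r` is a causal function
only for `a = 0`: `Σ·g⁻¹(dv, dv) = conormalForm M a r c (−1) = a²(1 − c²)` (`conormalForm_neg_one`)
vanishes for `a = 0` (`dv` null: ingoing EF) and is positive off the axis for `a ≠ 0`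
(`conormalForm_neg_one_pos`; Kerr: `g^{vv} = a² sin²θ/Σ`, the ingoing principal congruence twists).
References: Dafermos–Rodnianski arXiv:0811.0354 §5.1 (ingoing Kerr–Schild coordinates); O'Neill 1995,
Ch. 2 (Kerr causal structure); Visser arXiv:0706.0622 (32)–(35).
-/

noncomputable section

open Real Set

namespace Summit.FinalStateConjecture.FinalStateConjecture.Theorems.KerrShieldedSettles.Negative

open Literature.Geometry.Lorentzian
open Summit.FinalStateConjecture.FinalStateConjecture.Theorems.KerrShieldedDataExist.Negative
  (conormalForm delta_factor mass_pos rMinus_nonneg rMinus_lt_rPlus)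

/-! ## (1) Orientation audit of the tree's Kerr–Schild chart (`a = 0`) -/

/-- The Kerr–Schild null covector for `a = 0`: `ℓ(w) = w⁰ + (x⃗·w⃗)/|x⃗|` (Dafermos–Rodnianski
arXiv:0811.0354, §5.1). [cite: arXiv08110354, §5.1] -/
theorem nullCovector_zero_spin_apply (x w : E4) (hx : 0 < E4.spatialNorm x) :
    Kerr.nullCovector 0 x w = w 0 + (x 1 * w 1 + x 2 * w 2 + x 3 * w 3) / E4.spatialNorm x := by
  have hr : Kerr.radius 0 x = E4.spatialNorm x := Kerr.radius_zero_left x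
  simp only [Kerr.nullCovector, Kerr.nullCovectorFun, E4.covector_apply, Fin.sum_univ_four,
    Fin.isValue, Matrix.cons_val_zero, Matrix.cons_val_one, Matrix.cons_val, hr]
  have hne : E4.spatialNorm x ≠ 0 := hx.ne'
  field_simp
  ring

/-- The Kerr–Schild scalar for `a = 0`: `H = M/|x⃗|` (Visser arXiv:0706.0622, (33)). [cite: arXiv07060622, (33)] -/
theorem scalarH_zero_spin (M : ℝ) (x : E4) (hx : 0 < E4.spatialNorm x) :
    Kerr.scalarH M 0 x = M / E4.spatialNorm x := by
  have hr : Kerr.radius 0 x = E4.spatialNorm x := Kerr.radius_zero_left x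
  simp only [Kerr.scalarH, hr]
  have hne : E4.spatialNorm x ≠ 0 := hx.ne'
  field_simp
  ring

/-- **The tree's Schwarzschild metric is the INGOING Eddington–Finkelstein form**:
`g_{M,0}(x)(w, w) = −(w⁰)² + |w⃗|² + (2M/r)(w⁰ + x⃗·w⃗/r)²`, `r = |x⃗|` (i.e. `η + (2M/r)(dt* + dr)²`,
`v = t* + r` constant along the straight ingoing principal rays). Dafermos–Rodnianski
arXiv:0811.0354, §5.1. [cite: arXiv08110354, §5.1] -/
theorem bilin_zero_spin_self (M : ℝ) (x w : E4) (hx : 0 < E4.spatialNorm x) :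
    Kerr.bilin M 0 x w w = -(w 0) ^ 2 + (w 1 ^ 2 + w 2 ^ 2 + w 3 ^ 2)
      + 2 * (M / E4.spatialNorm x) *
        (w 0 + (x 1 * w 1 + x 2 * w 2 + x 3 * w 3) / E4.spatialNorm x) ^ 2 := by
  rw [Kerr.bilin_apply, nullCovector_zero_spin_apply x w hx, scalarH_zero_spin M x hx,
    Minkowski.bilin_apply]
  simp only [Fin.sum_univ_three, Fin.isValue]
  have e1 : ((1 : Fin 3).succ : Fin 4) = 2 := rfl
  have e2 : ((2 : Fin 3).succ : Fin 4) = 3 := rfl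
  simp only [Fin.succ_zero_eq_one, e1, e2]
  ring

/-- **Light cones of `g = η + 2Hℓ⊗ℓ` lie inside those of `η`** (`H ≥ 0`): `η(w,w) ≤ g(w,w)` for
every spin `a`, every point and every `M ≥ 0` (so `J⁺_g(S) ⊆ J⁺_η(S)`). Kerr–Schild 1965. [folklore] -/
theorem minkowski_le_bilin {M : ℝ} (hM : 0 ≤ M) (a : ℝ) (x w : E4) :
    Minkowski.bilin w w ≤ Kerr.bilin M a x w w := by
  rw [Kerr.bilin_apply]
  have h1 : 0 ≤ 2 * Kerr.scalarH M a x := by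
    have := Kerr.scalarH_nonneg hM a x
    linarith
  have h2 : 0 ≤ Kerr.nullCovector a x w * Kerr.nullCovector a x w := mul_self_nonneg _
  nlinarith [mul_nonneg h1 h2]

/-- **Speed limit**: a `g`-causal vector has Euclidean spatial part bounded by its `t*`-component,
`|w⃗|² ≤ (w⁰)²` (all `a`, `M ≥ 0`). [folklore] -/
theorem spatial_sq_le_of_causal {M : ℝ} (hM : 0 ≤ M) (a : ℝ) (x w : E4)
    (hc : Kerr.bilin M a x w w ≤ 0) : w 1 ^ 2 + w 2 ^ 2 + w 3 ^ 2 ≤ (w 0) ^ 2 := by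
  have h := (minkowski_le_bilin hM a x w).trans hc
  rw [Minkowski.bilin_apply] at h
  simp only [Fin.sum_univ_three, Fin.isValue] at h
  have e1 : ((1 : Fin 3).succ : Fin 4) = 2 := rfl
  have e2 : ((2 : Fin 3).succ : Fin 4) = 3 := rfl
  simp only [Fin.succ_zero_eq_one, e1, e2] at h
  nlinarith [h]

/-- **Future = increasing `t*`** for the tree's orientation `V = Kerr.timeVector = −g♯dt*`:
`g(V, w) = −w⁰` (tree lemma `Kerr.bilin_timeVector`), so `g(V, w) < 0 ↔ 0 < w⁰`.
Dafermos–Rodnianski arXiv:0811.0354, §5.1. [cite: arXiv08110354, §5.1] -/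
theorem bilin_timeVector_neg_iff {M a : ℝ} {x : E4} (hx : 0 < Kerr.radius a x) (w : E4) :
    Kerr.bilin M a x (Kerr.timeVector M a x) w < 0 ↔ 0 < w 0 := by
  rw [Kerr.bilin_timeVector hx]
  constructor <;> intro h <;> linarith

/-- **BLACK-hole orientation**: inside `r < 2M` every future-directed (`w⁰ > 0`) causal vector of
the tree's Schwarzschild metric points strictly INWARD, `x⃗·w⃗ < 0`; `{r = 2M}` is a future
(event) horizon for `−g♯dt*`. O'Neill 1995, Ch. 2. [folklore] -/
theorem infall_of_causal_inside {M : ℝ} {x w : E4} (hx : 0 < E4.spatialNorm x)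
    (hin : E4.spatialNorm x < 2 * M) (hc : Kerr.bilin M 0 x w w ≤ 0) (hw : 0 < w 0) :
    x 1 * w 1 + x 2 * w 2 + x 3 * w 3 < 0 := by
  rw [bilin_zero_spin_self M x w hx] at hc
  set r := E4.spatialNorm x with hr
  set p := x 1 * w 1 + x 2 * w 2 + x 3 * w 3 with hp
  have hr2 : r ^ 2 = x 1 ^ 2 + x 2 ^ 2 + x 3 ^ 2 := E4.spatialNorm_sq x
  -- Cauchy–Schwarz: p² ≤ r² |w⃗|²
  have hCS : p ^ 2 ≤ r ^ 2 * (w 1 ^ 2 + w 2 ^ 2 + w 3 ^ 2) := by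
    rw [hr2, hp]
    nlinarith [sq_nonneg (x 1 * w 2 - x 2 * w 1), sq_nonneg (x 1 * w 3 - x 3 * w 1),
      sq_nonneg (x 2 * w 3 - x 3 * w 2)]
  by_contra hcon
  rw [not_lt] at hcon
  have hρ : 0 ≤ p / r := div_nonneg hcon hx.le
  have hw2 : (p / r) ^ 2 ≤ w 1 ^ 2 + w 2 ^ 2 + w 3 ^ 2 := by
    rw [div_pow, div_le_iff₀ (by positivity)]
    linarith [hCS]
  have hsq : (w 0) ^ 2 ≤ (w 0 + p / r) ^ 2 := by nlinarith
  have hMr : 1 < 2 * (M / r) := by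
    rw [mul_div_assoc', lt_div_iff₀ hx]; linarith
  have key : 0 < -(w 0) ^ 2 + (w 1 ^ 2 + w 2 ^ 2 + w 3 ^ 2)
      + 2 * (M / r) * (w 0 + p / r) ^ 2 := by
    have hw0 : 0 < (w 0) ^ 2 := by positivity
    nlinarith [mul_le_mul_of_nonneg_left hsq (show 0 ≤ 2 * (M / r) by linarith), hρ]
  linarith

/-- … and ON the horizon `r = 2M` no future causal vector points outward: `x⃗·w⃗ ≤ 0` (the
covector form of "past-directed causal curves from the exterior never enter `{r < 2M}`").
O'Neill 1995, Ch. 2. [folklore] -/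
theorem not_outward_of_causal_horizon {M : ℝ} {x w : E4} (hx : 0 < E4.spatialNorm x)
    (hon : E4.spatialNorm x = 2 * M) (hc : Kerr.bilin M 0 x w w ≤ 0) (hw : 0 < w 0) :
    x 1 * w 1 + x 2 * w 2 + x 3 * w 3 ≤ 0 := by
  rw [bilin_zero_spin_self M x w hx] at hc
  set r := E4.spatialNorm x with hr
  set p := x 1 * w 1 + x 2 * w 2 + x 3 * w 3 with hp
  have hr2 : r ^ 2 = x 1 ^ 2 + x 2 ^ 2 + x 3 ^ 2 := E4.spatialNorm_sq x
  have hCS : p ^ 2 ≤ r ^ 2 * (w 1 ^ 2 + w 2 ^ 2 + w 3 ^ 2) := by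
    rw [hr2, hp]
    nlinarith [sq_nonneg (x 1 * w 2 - x 2 * w 1), sq_nonneg (x 1 * w 3 - x 3 * w 1),
      sq_nonneg (x 2 * w 3 - x 3 * w 2)]
  by_contra hcon
  rw [not_le] at hcon
  have hρ : 0 < p / r := div_pos hcon hx
  have hw2 : (p / r) ^ 2 ≤ w 1 ^ 2 + w 2 ^ 2 + w 3 ^ 2 := by
    rw [div_pow, div_le_iff₀ (by positivity)]
    linarith [hCS]
  have hM0 : M ≠ 0 := by
    intro h0; rw [h0] at hon; linarith
  have hMr : 2 * (M / r) = 1 := by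
    rw [hon]; field_simp
  rw [hMr] at hc
  nlinarith [hc, hw2, mul_pos hw hρ]

/-- `g(∂_{t*}, ∂_{t*}) = −1 + 2M/r` for `a = 0` (Dafermos–Rodnianski arXiv:0811.0354, §5.1). [cite: arXiv08110354, §5.1] -/
theorem bilin_basisVector_zero_self {M : ℝ} {x : E4} (hx : 0 < E4.spatialNorm x) :
    Kerr.bilin M 0 x (E4.basisVector 0) (E4.basisVector 0) = -1 + 2 * (M / E4.spatialNorm x) := by
  rw [bilin_zero_spin_self M x _ hx]
  simp [Fin.isValue]

/-- The stationary Killing field `∂_{t*}` is timelike exactly outside the horizon, `r > 2M`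
(`a = 0`; for `a ≠ 0` only outside the ergoregion, which is why the covering clause uses helical
observers). O'Neill 1995, Ch. 2. [folklore] -/
theorem stationary_timelike_iff {M : ℝ} {x : E4} (hx : 0 < E4.spatialNorm x) :
    Kerr.bilin M 0 x (E4.basisVector 0) (E4.basisVector 0) < 0 ↔ 2 * M < E4.spatialNorm x := by
  rw [bilin_basisVector_zero_self hx, mul_div_assoc']
  constructor
  · intro h
    have : 2 * M / E4.spatialNorm x < 1 := by linarith
    rwa [div_lt_one hx] at this
  · intro h
    have : 2 * M / E4.spatialNorm x < 1 := by rwa [div_lt_one hx]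
    linarith

/-! ## (2) The hole-collar constant, uniformly in `(M, a, r, c, κ)` -/

/-- Between the horizons `Δ < 0`, i.e. `r² + a² < 2Mr` (sub-extremal). [folklore] -/
theorem sq_add_sq_lt_of_mem_hole {M a r : ℝ} (ha : |a| < M) (h₁ : Kerr.rMinus M a < r)
    (h₂ : r < Kerr.rPlus M a) : r ^ 2 + a ^ 2 < 2 * M * r := by
  have hΔ : r ^ 2 - 2 * M * r + a ^ 2 < 0 := by
    rw [delta_factor ha r]
    exact mul_neg_of_neg_of_pos (by linarith) (by linarith)
  linarith

/-- **Hole-collar constant** (TRIAGE-r2-3 S1): `conormalForm M a r c (−κ) < −Σ`, i.e. the covector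
`dt* + κ dr` is timelike (with room) for all `0 ≤ κ ≤ ½`, `r₋ < r < r₊`, `|a| < M` and every latitude
`c` — numerator `κ²(r² + a²) − 2Mr(1 − κ)² < 2Mr(2κ − 1) ≤ 0`. [folklore] -/
theorem conormalForm_hole_collar_lt {M a r κ : ℝ} (ha : |a| < M) (h₁ : Kerr.rMinus M a < r)
    (h₂ : r < Kerr.rPlus M a) (hκ0 : 0 ≤ κ) (hκ1 : κ ≤ 1 / 2) (c : ℝ) :
    conormalForm M a r c (-κ) < -(r ^ 2 + a ^ 2 * c ^ 2) := by
  have hM : 0 < M := mass_pos ha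
  have hr0 : 0 < r := by linarith [rMinus_nonneg ha]
  have hhole := sq_add_sq_lt_of_mem_hole ha h₁ h₂
  unfold conormalForm
  rw [show (1 + -κ) = 1 - κ by ring]
  have h3 : 2 * M * r * (2 * κ - 1) ≤ 0 :=
    mul_nonpos_of_nonneg_of_nonpos (by positivity) (by linarith)
  rcases eq_or_lt_of_le hκ0 with h0 | hκpos
  · rw [← h0]
    have : 0 < 2 * M * r := by positivity
    nlinarith
  · have h1' : κ ^ 2 * (r ^ 2 + a ^ 2) < κ ^ 2 * (2 * M * r) :=
      mul_lt_mul_of_pos_left hhole (by positivity)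
    nlinarith

/-- The future-pointing sign: for `t ≥ −1` the conormal `dt* − t dr` pairs negatively with `dt*`,
`Σ·g⁻¹(dt* − t dr, dt*) = −Σ − 2Mr(1 + t) < 0`, so on the set where it is timelike it lies in the same
half-cone as `dt*` and is positive on future causal vectors (used with `t = −κ`, `κ ≤ ½`). [folklore] -/
theorem conormal_pairing_dt_neg {M r t : ℝ} (hM : 0 ≤ M) (hr : 0 < r) (ht : -1 ≤ t) (a c : ℝ) :
    -(r ^ 2 + a ^ 2 * c ^ 2) - 2 * M * r * (1 + t) < 0 := by
  have h1 : 0 < r ^ 2 + a ^ 2 * c ^ 2 := by positivity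
  have h2 : 0 ≤ 2 * M * r * (1 + t) := by
    have : 0 ≤ 1 + t := by linarith
    positivity
  linarith

/-! ## (3) `v = t* + r` is a causal function only for `a = 0` -/

/-- `Σ·g⁻¹(dv, dv) = conormalForm M a r c (−1) = a²(1 − c²)` for `v = t* + r`. [folklore] -/
theorem conormalForm_neg_one (M a r c : ℝ) : conormalForm M a r c (-1) = a ^ 2 * (1 - c ^ 2) := by
  unfold conormalForm
  ring

/-- `a = 0`: `dv` is null (`v` is the ingoing Eddington–Finkelstein advanced time).
Dafermos–Rodnianski arXiv:0811.0354, §5.1. [cite: arXiv08110354, §5.1] -/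
theorem conormalForm_neg_one_zero_spin (M r c : ℝ) : conormalForm M 0 r c (-1) = 0 := by
  rw [conormalForm_neg_one]
  ring

/-- `a ≠ 0`, off the axis (`c² < 1`): `dv` is SPACELIKE (`g⁻¹(dv,dv) > 0`), so `v` is not
non-decreasing along future causal curves of Kerr (`g^{vv} = a² sin²θ/Σ`; O'Neill 1995, Ch. 2). [folklore] -/
theorem conormalForm_neg_one_pos {M a r c : ℝ} (ha : a ≠ 0) (hc : c ^ 2 < 1) :
    0 < conormalForm M a r c (-1) := by
  rw [conormalForm_neg_one]
  have ha2 : 0 < a ^ 2 := by positivity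
  nlinarith

end Summit.FinalStateConjecture.FinalStateConjecture.Theorems.KerrShieldedSettles.Negative

end
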